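import Summits.ABC.IUTFork.Joshi.ATS4TateDivisors
import Mathlib.Topology.Algebra.Module.FiniteDimension
import Mathlib.LinearAlgebra.Basis.VectorSpace
import Mathlib.NumberTheory.Padics.PadicNumbers
import HarnessLib

/-!
# [J-IV] Prop. 4.5.11 read literally over the `ℚ_{p_v}(1)`-cohomology of (4.5.9): the collated set `Ψ_{C,A}` is
# SUPPORT-DETERMINED (proof-only companion of `Joshi/ATS4TateDivisors.lean`; standard linear algebra, no new claim)

Proof-only companion file of the abc-iut cell, branch E «type Joshi's construction, test vs S» (rung LADDER-ABC:A2.E; seat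
abc-iut-E-t27, slot T-27; AUTHORS-FIRST sequel of the seat's own object file `Joshi/ATS4TateDivisors.lean`, p430169). SOURCE: K.
Joshi, *Construction of Arithmetic Teichmüller Spaces IV: Proof of the abc-conjecture*, arXiv:2403.10430**v2** («Preliminary version
for comments», UNREFEREED; bib `Joshi2024ATS4`); locators «p.N l.M» = line M of page file `pNNNN.txt` of the cell's render
`HOME/lit/renders/Joshi-arxiv-2403.10430/`. **No side is taken** on [IUTchIII] Cor. 3.12, on Joshi's claims, or on Mochizuki's
report on them (bib `Mochizuki2024JoshiReport`); typed ≠ proved; typed AS A CANDIDATE ≠ endorsed; what follows is a LOCATION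
in standard mathematics (linear algebra over a complete valued field), not a verdict on any author. No abc claim.

THE SENTENCE READ. [J-IV] Prop. 4.5.11 (p.44 l.1–14; statement l.8–12 verbatim): «Then there exists a subset
`Ψ_{C,A} ⊆ H^1(arith(L)_{y₀}, ℚ(1))` which consists of the union, over `z ∈ A`, of the images of all the subsets `Ψ_z` [sc. the
classes `T̃I_{C/arith(L)_z}` of l.5–7] under all the isomorphisms (of topological groups) of each factor of
`H^1(arith(L)_z, ℚ(1)) ≃ H^1(arith(L)_y, ℚ(1))`» (proof l.13–14: «This is immediate on taking `Ψ_{C,A} = {T̃I_{C/arith(L)_z} : y ∈ Ψ}`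
in [Joshi, 2023a, Proposition 7.5.1]»), typed by this seat as the construction `TateIdeleDatum.collatedTateClasses` (the
ORBIT-UNION of the Tate classes under factorwise topological-group isomorphisms `σ_v : H z v ≃ₜ+ H y₀ v`, p430169). The factors:
(4.5.7) `L̃*_v = lim_n L_v^*/(L_v^*)^{p_v^n}` (p.43 l.39–52), (4.5.8) «by Kummer Theory, one has the natural identification
`L̃*_v ≃ H^1(G_{L_v}, ℚ_{p_v}(1))`» (l.53–56), (4.5.9) `∏_v L̃*_v = H^1(arith(L), ℚ(1))` (l.57–63). READING TYPED HERE: the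
coefficients AS PRINTED in (4.5.8)–(4.5.10) and in Prop. 4.5.11 — `ℚ_{p_v}(1)`, resp. `ℚ(1)` — under which each factor
`H^1(G_{L_v}, ℚ_{p_v}(1))` is a Hausdorff topological `ℚ_{p_v}`-VECTOR SPACE of finite dimension (`[L_v : ℚ_{p_v}] + 1`). INFO for
the faithfulness lane (located, no side): the inverse limit (4.5.7) itself is, by Kummer theory, the `ℤ_{p_v}(1)`-cohomology (a
compact `ℤ_{p_v}`-module with torsion), i.e. print's (4.5.7)/(4.5.8) carry a `ℤ_{p_v}`-vs-`ℚ_{p_v}` coefficient wobble; the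
`ℤ(1)`-reading of the same collation sentence ([ATS II½] Prop. 7.5.1, Def. 7.2.4) is E-t38's `Joshi/ArithmeticoidCollation*.lean`
(there: prime-to-`p_v` POWER maps are admissible, `pow_mem_collationAll` p433447). This file does NOT assert (4.5.8); the
vector-space structure enters only as typeclass HYPOTHESES on the standard factors `H y₀ v` (a module structure over a complete
nontrivially normed field `𝕜 v` with continuous scalar action, Hausdorff, finite-dimensional), under which every `𝕜 v`-linear
automorphism is an isomorphism of topological groups.

WHAT IS PROVED (the collation read literally = reading W of [ATS II½] Prop. 7.5.1 in the cell's vocabulary; here over the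
`ℚ(1)`-coefficients that [J-IV] (4.5.8)–(4.5.10) / Prop. 4.5.11 print):
1. (§1, [folklore]) `exists_linearEquiv_apply_eq` / `exists_continuousAddEquiv_apply_eq`: on such a factor the topological-group
   automorphisms act TRANSITIVELY on the nonzero vectors.
2. (§2) `support_of_mem_collatedTateClasses` (hypothesis-free): every element of `Ψ_{C,A}` has, factor by factor, the ZERO
   PATTERN of the Tate class of some `z ∈ A`; `mem_collatedTateClasses_of_support`: conversely, given ONE factorwise
   identification `τ_v : H z v ≃ₜ+ H y₀ v` (Joshi: the isomorphisms «provided by [ATS II½] Proposition 7.4.1» exist), EVERY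
   tuple with that zero pattern lies in `Ψ_{C,A}`. Hence `collatedTateClasses_eq_support`:
   `Ψ_{C,A} = {x | ∃ z ∈ A, ∀ v, (x_v = 0 ↔ T̃I_{z,v} = 0)}` — the collated set remembers NOTHING of the Tate classes but their
   supports.
3. (§3) Since `q_v = 1` off the semistable support `V` (class `0`, `tateClass_eq_zero_of_not_mem_bad`), if the Kummer classes of
   the Tate parameters are nonzero on `V` then `Ψ_{C,A} = {x | ∀ v, (x_v = 0 ↔ v ∉ V)}` for EVERY non-empty `A`
   (`collatedTateClasses_eq_of_support_bad`): independent of `A`, of the Tate parameters, of `ord_v`, of the Kummer maps and of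
   «log v», and equal for any two non-empty `A` (`collatedTateClasses_eq_of_nonempty`).
   In particular (`kum_pow_tateIdele_mem_collatedTateClasses`) the class of the idele `(q_v^{n_v})_v` is a collation-translate of
   the class of `(q_v)_v` for EVERY family of nonzero integers `n_v` — including `n_v = p_v^k` and `n_v = j²` — whereas over the
   `ℤ_{p_v}(1)`-cohomology only prime-to-`p_v` powers are reached (E-t38 `pow_mem_collationAll`, p433447).
4. (§4) NON-VACUITY: the hypotheses of §2–§3 are jointly inhabited (one place, factor `ℚ_p`, `K = ℤ` written multiplicatively,
   Kummer map `n ↦ n`, Tate parameter of valuation `1`; the witness is built inside the proof, no `def`): there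
   `Ψ_{C,A} = {x | x ≠ 0} ∋ p^k` for every `k` (`collatedTateClasses_nonvacuous`).
WHY IT MATTERS FOR THE CELL (dictionary row D-10 «collation isomorphisms ↦ ⟨(Ind1) ∪ (Ind2)⟩»; register flag F-h at
J4:Prop4.5.12, ref-x; located, NOT adjudicated). Prop. 4.5.12's non-constancy of `z ↦ log(TI_{C/arith(L)_z})` is printed as «clear
from the previous proposition» (p.44 l.33); read literally over `ℚ(1)`-coefficients, the previous proposition's set `Ψ_{C,A}` is
support-determined, so whatever varies with `z` is not recorded by `Ψ_{C,A}` itself but by the choice of identifications — the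
same attach point as E-t38's N-vs-W dichotomy ([ATS II½] Prop. 7.4.1 «provided» isomorphisms vs all topological ones) and as
this seat's gen-3 location (normalised degree `z`-free on transported carriers, `Joshi/ATS4TateDivisorsOverDeformation.lean`
p444143). Which isomorphisms print intends is a question for the faithfulness lane (E-ref), not decided here. OUR side's nearest
object (`Cor312.Setting.possibleImages`, the `⟨(Ind1) ∪ (Ind2)⟩`-translates S quantifies over) is NAMED only — no frozen decl is
imported or bound (E-PLAN R14). Standard axioms only; sorry-free; no new `def … : Prop`, no instance, no notation.
[claim: Joshi2024ATS4, status: disputed]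
-/

noncomputable section

open Set

namespace Summit.ABC.IUTFork.Joshi.ATS4

/-! ## 1. Linear algebra: the automorphisms of a vector space act transitively on nonzero vectors [folklore] -/

section LinearAlgebra

variable {K E : Type*} [Field K] [AddCommGroup E] [Module K E]

/-- Over a field, for any two NONZERO vectors `x, y` there is a linear automorphism carrying `x` to `y` (if `y = c • x`
take the homothety `c`; otherwise `x, y` are linearly independent, extend them to a basis and swap the two basis vectors).
[folklore] -/
theorem exists_linearEquiv_apply_eq {x y : E} (hx : x ≠ 0) (hy : y ≠ 0) : ∃ f : E ≃ₗ[K] E, f x = y := by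
  classical
  by_cases hdep : ∃ c : K, c • x = y
  · obtain ⟨c, rfl⟩ := hdep
    have hc : c ≠ 0 := by
      rintro rfl
      exact hy (zero_smul K x)
    exact ⟨LinearEquiv.smulOfNeZero K E c hc, rfl⟩
  · have hli : LinearIndependent K ![x, y] :=
      (LinearIndependent.pair_iff' hx).2 fun a ha => hdep ⟨a, ha⟩
    have hs := hli.linearIndepOn_id
    have hxm : x ∈ hs.extend (Set.subset_univ _) := Module.Basis.subset_extend hs ⟨0, by simp⟩
    have hym : y ∈ hs.extend (Set.subset_univ _) := Module.Basis.subset_extend hs ⟨1, by simp⟩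
    set b := Module.Basis.extend hs with hb
    have hbx : b ⟨x, hxm⟩ = x := congrFun (Module.Basis.coe_extend hs) _
    have hby : b ⟨y, hym⟩ = y := congrFun (Module.Basis.coe_extend hs) _
    refine ⟨b.equiv b (Equiv.swap ⟨x, hxm⟩ ⟨y, hym⟩), ?_⟩
    have key : b.equiv b (Equiv.swap ⟨x, hxm⟩ ⟨y, hym⟩) (b ⟨x, hxm⟩) = y := by
      rw [Module.Basis.equiv_apply, Equiv.swap_apply_left, hby]
    rwa [hbx] at key

end LinearAlgebra

section Topological

/-- On a finite-dimensional Hausdorff topological vector space over a complete nontrivially normed field (e.g. the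
`ℚ_{p_v}`-vector space `H^1(G_{L_v}, ℚ_{p_v}(1))` of [J-IV] (4.5.7)–(4.5.9)), the isomorphisms OF TOPOLOGICAL GROUPS act
transitively on nonzero vectors: every linear automorphism is bicontinuous. [folklore] -/
theorem exists_continuousAddEquiv_apply_eq {𝕜 E : Type*} [NontriviallyNormedField 𝕜] [CompleteSpace 𝕜]
    [AddCommGroup E] [Module 𝕜 E] [TopologicalSpace E] [IsTopologicalAddGroup E] [ContinuousSMul 𝕜 E] [T2Space E]
    [FiniteDimensional 𝕜 E] {x y : E} (hx : x ≠ 0) (hy : y ≠ 0) : ∃ σ : E ≃ₜ+ E, σ x = y := by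
  obtain ⟨f, hf⟩ := exists_linearEquiv_apply_eq (K := 𝕜) hx hy
  let F : E ≃L[𝕜] E := f.toContinuousLinearEquiv
  let σ : E ≃ₜ+ E :=
    { F.toLinearEquiv.toAddEquiv with
      continuous_toFun := F.continuous
      continuous_invFun := F.symm.continuous }
  exact ⟨σ, hf⟩

end Topological

/-! ## 2. [J-IV] Prop. 4.5.11 read literally: `Ψ_{C,A}` is determined by the zero patterns of the Tate classes -/

namespace TateIdeleDatum

variable {Y V : Type} [DecidableEq V] {K : Y → V → Type} [∀ z v, CommGroup (K z v)] {H : Y → V → Type}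
  [∀ z v, AddCommGroup (H z v)] [∀ z v, TopologicalSpace (H z v)] (D : TateIdeleDatum Y V K H)

/-- Hypothesis-free half: an element of `Ψ_{C,A}` vanishes at exactly the places where the Tate class it comes from vanishes
(a group isomorphism preserves `0` and nonzero-ness). [claim: Joshi2024ATS4, status: disputed] -/
theorem support_of_mem_collatedTateClasses {A : Set Y} {x : ∀ v : V, H D.std v} (hx : x ∈ D.collatedTateClasses A) :
    ∃ z ∈ A, ∀ v, x v = 0 ↔ D.tateClass z v = 0 := by
  obtain ⟨z, hz, σ, rfl⟩ := hx
  exact ⟨z, hz, fun v => EmbeddingLike.map_eq_zero_iff⟩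

/-- Off the semistable support `V` the Tate idele is `1` ((4.5.2) «q_v = 1 if v ∉ V»), so its class vanishes there — for every
arithmeticoid `z`. Hypothesis-free. [claim: Joshi2024ATS4, status: disputed] -/
theorem tateClass_eq_zero_of_not_mem_bad (z : Y) {v : V} (hv : v ∉ D.bad) : D.tateClass z v = 0 := by
  simp [tateClass, tateIdele, hv]

section Transitive

variable (𝕜 : V → Type) [∀ v, NontriviallyNormedField (𝕜 v)] [∀ v, CompleteSpace (𝕜 v)]
  [∀ v, Module (𝕜 v) (H D.std v)] [∀ v, ContinuousSMul (𝕜 v) (H D.std v)] [∀ v, IsTopologicalAddGroup (H D.std v)]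
  [∀ v, T2Space (H D.std v)] [∀ v, FiniteDimensional (𝕜 v) (H D.std v)]

include 𝕜

/-- **Transitivity of the literal collation.** Let the STANDARD factors `H y₀ v` be finite-dimensional Hausdorff topological
vector spaces over complete nontrivially normed fields `𝕜 v` (as `H^1(G_{L_v}, ℚ_{p_v}(1))` is over `ℚ_{p_v}`, [J-IV] (4.5.9)).
If `z ∈ A` and ONE factorwise identification `τ_v : H z v ≃ₜ+ H y₀ v` is given (the isomorphisms «provided by [ATS II½]
Proposition 7.4.1»), then EVERY tuple `x` with the zero pattern of `T̃I_z` lies in `Ψ_{C,A}`: at a place where the class is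
nonzero, compose `τ_v` with a topological-group automorphism of `H y₀ v` moving `τ_v(T̃I_{z,v})` to `x_v`. Located, not
adjudicated. [claim: Joshi2024ATS4, status: disputed] -/
theorem mem_collatedTateClasses_of_support {A : Set Y} {z : Y} (hz : z ∈ A) (τ : ∀ v : V, H z v ≃ₜ+ H D.std v)
    {x : ∀ v : V, H D.std v} (hx : ∀ v, x v = 0 ↔ D.tateClass z v = 0) : x ∈ D.collatedTateClasses A := by
  have key : ∀ v, ∃ σ : H z v ≃ₜ+ H D.std v, σ (D.tateClass z v) = x v := by
    intro v
    by_cases h0 : D.tateClass z v = 0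
    · exact ⟨τ v, by rw [h0, (hx v).2 h0, map_zero]⟩
    · have hx0 : x v ≠ 0 := fun h => h0 ((hx v).1 h)
      have hτ0 : τ v (D.tateClass z v) ≠ 0 := fun h => h0 (EmbeddingLike.map_eq_zero_iff.1 h)
      obtain ⟨ρ, hρ⟩ := exists_continuousAddEquiv_apply_eq (𝕜 := 𝕜 v) hτ0 hx0
      exact ⟨(τ v).trans ρ, by rw [ContinuousAddEquiv.trans_apply, hρ]⟩
  choose σ hσ using key
  exact ⟨z, hz, σ, funext fun v => (hσ v).symm⟩

/-- **`Ψ_{C,A}` is support-determined** (Prop. 4.5.11 read literally over `ℚ(1)`-coefficients): given factorwise identifications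
for every `z ∈ A`, `Ψ_{C,A} = {x | ∃ z ∈ A, ∀ v, (x_v = 0 ↔ T̃I_{z,v} = 0)}`. Located, not adjudicated.
[claim: Joshi2024ATS4, status: disputed] -/
theorem collatedTateClasses_eq_support {A : Set Y} (τ : ∀ z ∈ A, ∀ v : V, H z v ≃ₜ+ H D.std v) :
    D.collatedTateClasses A = {x | ∃ z ∈ A, ∀ v, x v = 0 ↔ D.tateClass z v = 0} := by
  ext x
  refine ⟨fun hx => D.support_of_mem_collatedTateClasses hx, ?_⟩
  rintro ⟨z, hz, hx⟩
  exact D.mem_collatedTateClasses_of_support 𝕜 hz (τ z hz) hx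

/-- The standard arithmeticoid needs no identification hypothesis (`τ` = identity, [J-IV] Rmk. 4.5.13 (2)): if `y₀ ∈ A`, every
tuple with the zero pattern of `T̃I_{y₀}` is in `Ψ_{C,A}`. [claim: Joshi2024ATS4, status: disputed] -/
theorem mem_collatedTateClasses_of_support_std {A : Set Y} (hA : D.std ∈ A) {x : ∀ v : V, H D.std v}
    (hx : ∀ v, x v = 0 ↔ D.tateClass D.std v = 0) : x ∈ D.collatedTateClasses A :=
  D.mem_collatedTateClasses_of_support 𝕜 hA (fun v => ContinuousAddEquiv.refl (H D.std v)) hx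

/-- Nonzero RESCALINGS of the standard Tate class are collation-translates of it: for `y₀ ∈ A` and any family of nonzero
scalars `c_v ∈ 𝕜 v`, `(c_v • T̃I_{y₀,v})_v ∈ Ψ_{C,A}`. [claim: Joshi2024ATS4, status: disputed] -/
theorem smul_tateClass_mem_collatedTateClasses {A : Set Y} (hA : D.std ∈ A) (c : ∀ v, 𝕜 v) (hc : ∀ v, c v ≠ 0) :
    (fun v => c v • D.tateClass D.std v) ∈ D.collatedTateClasses A :=
  D.mem_collatedTateClasses_of_support_std 𝕜 hA fun v => by simp [hc v]

/-- **Every nonzero POWER of the Tate idele is reached.** For `y₀ ∈ A` and any family of NONZERO integers `n_v` (e.g.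
`n_v = p_v^k`, or `n_v = j²`), the Kummer class of the idele `(q_v^{n_v})_v` — computed in the standard arithmeticoid — lies
in `Ψ_{C,A}` (the standard factors being vector spaces over fields of characteristic `0`, `n • c = 0 ↔ c = 0`). Contrast
(located, no side): over the `ℤ_{p_v}(1)`-cohomology only the powers prime to `p_v` are reached (E-t38
`ATS2half.pow_mem_collationAll`, `Joshi/ArithmeticoidCollationPowers.lean`). [claim: Joshi2024ATS4, status: disputed] -/
theorem kum_pow_tateIdele_mem_collatedTateClasses [∀ v, CharZero (𝕜 v)] {A : Set Y} (hA : D.std ∈ A) (n : V → ℤ)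
    (hn : ∀ v, n v ≠ 0) :
    (fun v => Multiplicative.toAdd (D.kum D.std v (D.tateIdele D.std v ^ n v))) ∈ D.collatedTateClasses A := by
  have h : (fun v => Multiplicative.toAdd (D.kum D.std v (D.tateIdele D.std v ^ n v))) =
      fun v => ((n v : ℤ) : 𝕜 v) • D.tateClass D.std v := by
    funext v
    rw [map_zpow, toAdd_zpow, Int.cast_smul_eq_zsmul]
    rfl
  rw [h]
  exact D.smul_tateClass_mem_collatedTateClasses 𝕜 hA _ fun v => Int.cast_ne_zero.2 (hn v)

/-- **`Ψ_{C,A}` forgets everything but the semistable support.** If the Kummer classes of the chosen Tate parameters are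
nonzero on `V` for the arithmeticoids in `A` (as for a genuine Tate parameter, `ord_v(q_v) > 0`, in `L̃*_v ⊗ ℚ`) and factorwise
identifications exist, then for every NON-EMPTY `A`: `Ψ_{C,A} = {x | ∀ v, (x_v = 0 ↔ v ∉ V)}` — independent of `A`, of the Tate
parameters, of `ord_v`, of the Kummer maps and of «log v». Located, not adjudicated. [claim: Joshi2024ATS4, status: disputed] -/
theorem collatedTateClasses_eq_of_support_bad {A : Set Y} (hA : A.Nonempty) (τ : ∀ z ∈ A, ∀ v : V, H z v ≃ₜ+ H D.std v)
    (hne : ∀ z ∈ A, ∀ v ∈ D.bad, D.tateClass z v ≠ 0) :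
    D.collatedTateClasses A = {x | ∀ v, x v = 0 ↔ v ∉ D.bad} := by
  have pat : ∀ z ∈ A, ∀ v, (D.tateClass z v = 0 ↔ v ∉ D.bad) := fun z hz v =>
    ⟨fun h hv => hne z hz v hv h, fun hv => D.tateClass_eq_zero_of_not_mem_bad z hv⟩
  rw [D.collatedTateClasses_eq_support 𝕜 τ]
  ext x
  simp only [mem_setOf_eq]
  constructor
  · rintro ⟨z, hz, hx⟩ v
    rw [hx v, pat z hz v]
  · intro hx
    obtain ⟨z, hz⟩ := hA
    exact ⟨z, hz, fun v => by rw [hx v, pat z hz v]⟩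

/-- In particular, under the same hypotheses for every arithmeticoid, `Ψ_{C,A}` does not depend on the non-empty subset
`A ⊆ 𝒴_L` at all: `Ψ_{C,A} = Ψ_{C,B}` for all non-empty `A, B` (contrast Prop. 4.5.11's «union over z ∈ A» and Prop. 4.5.12's
«if one takes A = 𝒴_L …»). Located, not adjudicated. [claim: Joshi2024ATS4, status: disputed] -/
theorem collatedTateClasses_eq_of_nonempty (τ : ∀ (z : Y) (v : V), H z v ≃ₜ+ H D.std v)
    (hne : ∀ (z : Y), ∀ v ∈ D.bad, D.tateClass z v ≠ 0) {A B : Set Y} (hA : A.Nonempty) (hB : B.Nonempty) :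
    D.collatedTateClasses A = D.collatedTateClasses B := by
  rw [D.collatedTateClasses_eq_of_support_bad 𝕜 hA (fun z _ => τ z) (fun z _ => hne z),
    D.collatedTateClasses_eq_of_support_bad 𝕜 hB (fun z _ => τ z) (fun z _ => hne z)]

end Transitive

end TateIdeleDatum

/-! ## 4. Non-vacuity: the hypotheses of §2–§3 are jointly inhabited (one place, factor `ℚ_p`) -/

/-- NON-VACUITY of §3 (no `def`: the witness datum is built inside the proof). Toy §4.5 datum: one arithmeticoid, one
(semistable) place, `K = ℤ` written multiplicatively («`L_v^×` modulo units», `ord` the identity), Tate parameter of valuation `1`,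
standard factor `ℚ_p` (a one-dimensional stand-in for `H^1(G_{L_v}, ℚ_p(1))`), Kummer map `n ↦ n`, `[L:ℚ] = 1`, «log v» `= 1`.
There: the standard arithmeticoid lies in `A = {y₀}`, the Tate class is nonzero on the support (it is `1`), and the literal
collation of this SINGLE class is EVERYTHING NONZERO, `Ψ_{C,A} = {x | x ≠ 0}` — in particular it contains `p^k` (the class of
`q^{p^k}`, a `p`-POWER of the Tate parameter) for every `k`. Model data exhibit satisfiability, nothing more. [folklore] -/
theorem collatedTateClasses_nonvacuous (p : ℕ) [Fact p.Prime] :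
    ∃ D : TateIdeleDatum Unit Unit (fun _ _ => Multiplicative ℤ) (fun _ _ => ℚ_[p]),
      D.bad = {()} ∧ (∀ z v, D.tateClass z v = (1 : ℚ_[p])) ∧
        D.collatedTateClasses {D.std} = {x | ∀ v, x v ≠ 0} ∧
          ∀ k : ℕ, (fun _ => (p : ℚ_[p]) ^ k) ∈ D.collatedTateClasses {D.std} := by
  let D : TateIdeleDatum Unit Unit (fun _ _ => Multiplicative ℤ) (fun _ _ => ℚ_[p]) :=
    { std := ()
      bad := {()}
      degQ := 1
      degQ_pos := Nat.one_pos
      ord := fun _ _ => MonoidHom.id _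
      q := fun _ _ => Multiplicative.ofAdd 1
      kum := fun _ _ => AddMonoidHom.toMultiplicative (Int.castAddHom ℚ_[p])
      logN := fun _ _ => 1 }
  have hcl : ∀ z v, D.tateClass z v = (1 : ℚ_[p]) := fun z v => by
    simp [TateIdeleDatum.tateClass, TateIdeleDatum.tateIdele, D]
  have hΨ : D.collatedTateClasses {D.std} = {x | ∀ v, x v ≠ 0} := by
    rw [D.collatedTateClasses_eq_of_support_bad (fun _ => ℚ_[p]) (Set.singleton_nonempty _)
      (fun z _ v => ContinuousAddEquiv.refl _) fun z _ v _ => by rw [hcl]; exact one_ne_zero]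
    ext x
    simp [D]
  refine ⟨D, rfl, hcl, hΨ, fun k => ?_⟩
  rw [hΨ]
  intro v
  simp [(Fact.out : p.Prime).ne_zero]

end Summit.ABC.IUTFork.Joshi.ATS4

end
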